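import Mathlib
import Summits.AtomisticToContinuum.BoseEinsteinCondensation.Theorems.SoloInformedGaussianDomination

/-!
# Direct/exchange (impurity) split of the particle-addition susceptibility

Conjunct `BoseEinsteinCondensation` of `AtomisticToContinuum` — soloist report `paper/sharpest.md`
§4.10(x), claims C58–C59.  Companion to `SoloInformedGaussianDomination` (the door
`(n_k+1)² ≤ χ₊(k)(k² + 2ρ‖v‖₁ + μ₋ n_k)`), `SoloInformedTwoBodyDomination` (rung 0) and
`SoloInformedResolventSplit` (the all-`N` criterion): the structural facts behind the split
`χ₊ = D + X` of the one-sided `T = 0` susceptibility into a DIRECT part `D` — the susceptibility of an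
equal-mass DISTINGUISHABLE impurity — and an EXCHANGE part `X`, and the one rigorous bound on `D`
that is not an infrared input.

Abstract statements (inner product space over `ℂ`; "weak inverse": `h u = F`):

* `SoloInformed.re_inner_weakInverse_le_of_form_le` — **resolvent monotonicity**: if `h₁` is
  symmetric, `0 ≤ re⟨x, h₁ x⟩ ≤ re⟨x, h x⟩` for all `x`, `h u = F` and `h₁ u₁ = F`, then
  `re⟨F, u⟩ ≤ re⟨F, u₁⟩` (two Cauchy–Schwarz steps; no invertibility, no spectral theory);
* `SoloInformed.re_inner_weakInverse_le_of_eigenvector` — if moreover `h₁ F = λ F` with `0 < λ`,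
  then `re⟨F, u⟩ ≤ ‖F‖² / λ`;
* `SoloInformed.re_inner_weakInverse_le_of_form_bound` — if `e ‖x‖² ≤ re⟨x, h x⟩` for all `x`
  with `0 < e` and `h u = F`, then `re⟨F, u⟩ ≤ ‖F‖² / e`;
* `SoloInformed.exchange_split` — for a family `F : Fin (N+1) → E` and a linear `R` with
  `re⟨F i, R (F i)⟩ = α` and `re⟨F i, R (F j)⟩ = β` (`i ≠ j`):
  `re⟨Σ F i, R (Σ F i)⟩ = (N+1)(α + N β)`;
* `SoloInformed.exchange_le_direct` — if `R` is positive (`0 ≤ re⟨x, R x⟩`) and `1 ≤ N`, then `β ≤ α`;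
* `SoloInformed.direct_dominates_iff` — for `1 ≤ N`: `α + N β ≤ α ↔ β ≤ 0`.

Physical reading (torus or lattice `Λ`, repulsive pair interaction `v ≥ 0`, `N`-boson ground state
`Ψ₀`, `h = H_{N+1} − E₀(N+1) ≥ 0` on `L²(Λ^{N+1})` WITHOUT symmetry constraint, momentum-`k` sector,
`R` = the inverse of `h` there).  First quantisation gives `a_k† Ψ₀ = (N+1)^{-1/2} Σ_j F_j`,
`F_j = φ_k(x_j) Ψ₀(x̂_j)`; permutation symmetry of `h` makes `re⟨F_i, R F_j⟩` depend only on
`i = j` (value `α = D`, the DIRECT part: particle `1` a distinguishable impurity of equal mass and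
equal coupling — computable in the Lee–Low–Pines frame) or `i ≠ j` (value `β = X/N`, EXCHANGE with
the condensate).  Then `exchange_split` is `χ₊(k) = D + X`, `exchange_le_direct` is the useless
Gram bound `X ≤ N D` (symmetrisation by Cauchy–Schwarz costs the factor `N+1`), and
`direct_dominates_iff` is `χ₊ ≤ D ⟺ X ≤ 0`.  For the direct part, `H_{N+1} = H¹ + W₁` with
`H¹ = T₁ + H_N(x̂₁)` (impurity decoupled), `W₁ = Σ_{j ≥ 2} v(x₁ − x_j) ≥ 0`, and
`H¹ F₁ = (ε(k) + E₀(N)) F₁`; so with `h₁ = H¹ − E₀(N+1)`, `λ = ε(k) − μ_N`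
(`μ_N = E₀(N+1) − E₀(N)`), `re_inner_weakInverse_le_of_eigenvector` gives
`D ≤ 1/(ε(k) − μ_N)` PROVIDED `H¹ − E₀(N+1) ≥ 0` on the sector, i.e.
`min_p [ε(p) + E₀(N, k−p) − E₀(N)] ≥ μ_N` — a gas sector-gap condition (true for `N = 1`, where it is
rung 0's `E₂ < inf K`; for general `N` an infrared input of Landau type; without it the bound fails,
e.g. `h₁ = diag(1, −1/2)`, `h = h₁ + [[1,1],[1,1]] ≥ 0`, `F = e₁`: `re⟨F, h⁻¹F⟩ = 2 > 1`), while
`re_inner_weakInverse_le_of_form_bound` gives `D ≤ 1/e_imp(k)` with `e_imp(k)` the bottom of `h` on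
the impurity's momentum-`k` sector (the Bose-polaron dispersion).  First order: `D = 1/ε`,
`X = −ρ v̂(k)/ε²`; Bogoliubov infrared: `χ₊/D → ≈ 1/4`.  The report's typing: complete BEC for dilute
positive-type `v` ⇐ (X) `χ₊ ≤ C₁ D` ∧ (D) `D ≤ C₂/ε` on `0 < |k| ≤ K√(ρa)`, uniformly in `L`; Bose
statistics enter only through (X) (the sign of the Fock term beyond perturbation theory; no tool),
and (D) follows from an impurity sector gap `e_imp ≥ ε/C₂` (open, and lossy: the ideal gas violates
it with `D = 1/ε`).  Exact diagonalisation (14 rings, 24 boundary cases, three `4×4` tori; report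
C58, C60): `sign X = −sign v̂(k)` at every momentum with `v̂(k) ≠ 0`, `χ₊/D ∈ [0.28, 0.79]` at the
smallest momentum.  Everything in this file is elementary; it records the algebra and the exact
hypothesis under which the direct part is free.
-/

noncomputable section

open Complex
open scoped InnerProductSpace ComplexConjugate BigOperators

namespace Summit.AtomisticToContinuum.BoseEinsteinCondensation.Theorems

universe v

variable {E : Type v} [NormedAddCommGroup E] [InnerProductSpace ℂ E]

section Monotone

/-- **Resolvent monotonicity from form domination.**  If `h₁` is symmetric with
`0 ≤ re⟨x, h₁ x⟩ ≤ re⟨x, h x⟩` for all `x`, and `h u = F`, `h₁ u₁ = F`, then `re⟨F, u⟩ ≤ re⟨F, u₁⟩`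
(for invertible positive operators: `h ≥ h₁ ≥ 0 ⇒ ⟨F, h⁻¹F⟩ ≤ ⟨F, h₁⁻¹F⟩`). [folklore: operator
monotonicity of the inverse, weak form] -/
theorem SoloInformed.re_inner_weakInverse_le_of_form_le (h h₁ : E →ₗ[ℂ] E)
    (h₁symm : ∀ x y : E, ⟪h₁ x, y⟫_ℂ = ⟪x, h₁ y⟫_ℂ)
    (h₁psd : ∀ x : E, 0 ≤ (⟪x, h₁ x⟫_ℂ).re)
    (hle : ∀ x : E, (⟪x, h₁ x⟫_ℂ).re ≤ (⟪x, h x⟫_ℂ).re)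
    {u u₁ F : E} (hu : h u = F) (hu₁ : h₁ u₁ = F) :
    (⟪F, u⟫_ℂ).re ≤ (⟪F, u₁⟫_ℂ).re := by
  -- a := re⟪F, u⟫ = re⟪u, h u⟫ ≥ a₁ := re⟪u, h₁ u⟫ ≥ 0;  b := re⟪F, u₁⟫ = re⟪u₁, h₁ u₁⟫ ≥ 0
  have ha : (⟪F, u⟫_ℂ).re = (⟪u, h u⟫_ℂ).re := by
    rw [hu, ← inner_conj_symm u F, Complex.conj_re]
  have hb : (⟪F, u₁⟫_ℂ).re = (⟪u₁, h₁ u₁⟫_ℂ).re := by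
    rw [hu₁, ← inner_conj_symm u₁ F, Complex.conj_re]
  -- the cross term: re⟪u₁, h₁ u⟫ = re⟪h₁ u₁, u⟫ = re⟪F, u⟫
  have hc : (⟪u₁, h₁ u⟫_ℂ).re = (⟪F, u⟫_ℂ).re := by
    rw [← h₁symm u₁ u, hu₁]
  have hCS := SoloInformed.form_cauchySchwarz h₁ h₁symm h₁psd u₁ u
  rw [hc] at hCS
  have ha₁ : 0 ≤ (⟪u, h₁ u⟫_ℂ).re := h₁psd u
  have ha₁a : (⟪u, h₁ u⟫_ℂ).re ≤ (⟪F, u⟫_ℂ).re := by rw [ha]; exact hle u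
  have hb0 : 0 ≤ (⟪F, u₁⟫_ℂ).re := by rw [hb]; exact h₁psd u₁
  rw [← hb] at hCS
  -- a² ≤ b·a₁ ≤ b·a, hence a ≤ b
  set a := (⟪F, u⟫_ℂ).re with ha_def
  set b := (⟪F, u₁⟫_ℂ).re with hb_def
  set a₁ := (⟪u, h₁ u⟫_ℂ).re with ha₁_def
  by_contra hlt
  push Not at hlt
  have hapos : 0 < a := lt_of_le_of_lt hb0 hlt
  have h1 : a ^ 2 ≤ b * a := le_trans hCS (mul_le_mul_of_nonneg_left ha₁a hb0)
  nlinarith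

/-- **Direct part free under the positivity proviso.**  If, in addition, `F` is an eigenvector of
`h₁` with eigenvalue `λ > 0`, then `re⟨F, u⟩ ≤ ‖F‖² / λ` for every weak inverse `h u = F`.
(Impurity reading: `D ≤ 1/(ε(k) − μ_N)` provided `H¹ − E₀(N+1) ≥ 0` on the sector.) [folklore] -/
theorem SoloInformed.re_inner_weakInverse_le_of_eigenvector (h h₁ : E →ₗ[ℂ] E)
    (h₁symm : ∀ x y : E, ⟪h₁ x, y⟫_ℂ = ⟪x, h₁ y⟫_ℂ)
    (h₁psd : ∀ x : E, 0 ≤ (⟪x, h₁ x⟫_ℂ).re)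
    (hle : ∀ x : E, (⟪x, h₁ x⟫_ℂ).re ≤ (⟪x, h x⟫_ℂ).re)
    {u F : E} {lam : ℝ} (hlam : 0 < lam) (hF : h₁ F = (lam : ℂ) • F) (hu : h u = F) :
    (⟪F, u⟫_ℂ).re ≤ ‖F‖ ^ 2 / lam := by
  have hne : (lam : ℂ) ≠ 0 := Complex.ofReal_ne_zero.mpr hlam.ne'
  have hu₁ : h₁ ((lam : ℂ)⁻¹ • F) = F := by
    rw [map_smul, hF, smul_smul, inv_mul_cancel₀ hne, one_smul]
  have key := SoloInformed.re_inner_weakInverse_le_of_form_le h h₁ h₁symm h₁psd hle hu hu₁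
  have hFF : (⟪F, F⟫_ℂ).re = ‖F‖ ^ 2 := by
    rw [← RCLike.re_to_complex, inner_self_eq_norm_sq]
  have hval : (⟪F, (lam : ℂ)⁻¹ • F⟫_ℂ).re = ‖F‖ ^ 2 / lam := by
    rw [inner_smul_right, ← Complex.ofReal_inv, Complex.re_ofReal_mul, hFF, inv_mul_eq_div]
  rw [hval] at key
  exact key

/-- **Direct part bounded by the sector bottom.**  If `e ‖x‖² ≤ re⟨x, h x⟩` for all `x` with
`0 < e`, then `re⟨F, u⟩ ≤ ‖F‖² / e` for every weak inverse `h u = F`.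
(Impurity reading: `D ≤ 1/e_imp(k)`, the Bose-polaron dispersion of the distinguishable copy.)
[folklore] -/
theorem SoloInformed.re_inner_weakInverse_le_of_form_bound (h : E →ₗ[ℂ] E) {e : ℝ} (he : 0 < e)
    (hbound : ∀ x : E, e * ‖x‖ ^ 2 ≤ (⟪x, h x⟫_ℂ).re) {u F : E} (hu : h u = F) :
    (⟪F, u⟫_ℂ).re ≤ ‖F‖ ^ 2 / e := by
  have ha : (⟪F, u⟫_ℂ).re = (⟪u, h u⟫_ℂ).re := by
    rw [hu, ← inner_conj_symm u F, Complex.conj_re]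
  have h1 : e * ‖u‖ ^ 2 ≤ (⟪F, u⟫_ℂ).re := by rw [ha]; exact hbound u
  have h2 : (⟪F, u⟫_ℂ).re ≤ ‖F‖ * ‖u‖ := le_trans (Complex.re_le_norm _) (norm_inner_le_norm F u)
  have hu0 : 0 ≤ ‖u‖ := norm_nonneg u
  have hF0 : 0 ≤ ‖F‖ := norm_nonneg F
  rw [le_div_iff₀ he]
  -- a·e ≤ ‖F‖²:  e‖u‖² ≤ a ≤ ‖F‖‖u‖ gives e‖u‖ ≤ ‖F‖ (or ‖u‖ = 0), then a e ≤ ‖F‖‖u‖e ≤ ‖F‖²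
  have h3 : e * ‖u‖ * ‖u‖ ≤ ‖F‖ * ‖u‖ := by nlinarith [h1, h2]
  rcases eq_or_lt_of_le hu0 with hu00 | hupos
  · -- ‖u‖ = 0: then a ≤ 0
    rw [← hu00, mul_zero] at h2
    nlinarith [sq_nonneg ‖F‖, he, h2]
  · have h4 : e * ‖u‖ ≤ ‖F‖ := le_of_mul_le_mul_right (by nlinarith [h3]) hupos
    have h7 : (⟪F, u⟫_ℂ).re * e ≤ ‖F‖ * ‖u‖ * e := mul_le_mul_of_nonneg_right h2 he.le
    have h8 : ‖F‖ * (e * ‖u‖) ≤ ‖F‖ * ‖F‖ := mul_le_mul_of_nonneg_left h4 hF0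
    nlinarith [h7, h8]

end Monotone

section Exchange

variable {N : ℕ}

/-- **The direct/exchange split.**  For a family `F : Fin (N+1) → E` and a linear map `R` with
`re⟨F i, R (F i)⟩ = α` for all `i` and `re⟨F i, R (F j)⟩ = β` for all `i ≠ j`,
`re⟨Σ F i, R (Σ F i)⟩ = (N+1)(α + N β)`.  (Bosons: `a_k†Ψ₀ = (N+1)^{-1/2} Σ F_j`, so
`χ₊ = α + N β = D + X`.) [folklore] -/
theorem SoloInformed.exchange_split (R : E →ₗ[ℂ] E) (F : Fin (N + 1) → E) {α β : ℝ}
    (hdiag : ∀ i, (⟪F i, R (F i)⟫_ℂ).re = α)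
    (hoff : ∀ i j, i ≠ j → (⟪F i, R (F j)⟫_ℂ).re = β) :
    (⟪∑ i, F i, R (∑ i, F i)⟫_ℂ).re = ((N : ℝ) + 1) * (α + N * β) := by
  have hij : ∀ i j, (⟪F i, R (F j)⟫_ℂ).re = β + (if i = j then α - β else 0) := by
    intro i j
    by_cases h : i = j
    · subst h; rw [hdiag, if_pos rfl]; ring
    · rw [hoff i j h, if_neg h]; ring
  rw [map_sum, sum_inner, Complex.re_sum]
  simp_rw [inner_sum, Complex.re_sum, hij, Finset.sum_add_distrib, Finset.sum_ite_eq,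
    Finset.mem_univ, if_true, Finset.sum_const, Finset.card_univ, Fintype.card_fin, nsmul_eq_mul]
  push_cast
  ring

/-- **Exchange is at most direct (the Gram bound).**  If moreover `R` is positive and `1 ≤ N`, then
`β ≤ α` — i.e. `X ≤ N D`: the bound obtained by symmetrising a distinguishable-particle estimate
loses exactly the factor `N + 1`. [folklore] -/
theorem SoloInformed.exchange_le_direct (R : E →ₗ[ℂ] E) (hpsd : ∀ x : E, 0 ≤ (⟪x, R x⟫_ℂ).re)
    (F : Fin (N + 1) → E) {α β : ℝ} (hN : 1 ≤ N)
    (hdiag : ∀ i, (⟪F i, R (F i)⟫_ℂ).re = α)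
    (hoff : ∀ i j, i ≠ j → (⟪F i, R (F j)⟫_ℂ).re = β) : β ≤ α := by
  have h01 : (⟨0, Nat.succ_pos N⟩ : Fin (N + 1)) ≠ ⟨1, Nat.succ_lt_succ_iff.mpr (by omega)⟩ := by
    simp [Fin.ext_iff]
  set i0 : Fin (N + 1) := ⟨0, Nat.succ_pos N⟩
  set i1 : Fin (N + 1) := ⟨1, Nat.succ_lt_succ_iff.mpr (by omega)⟩
  have h := hpsd (F i0 - F i1)
  rw [map_sub, inner_sub_left, inner_sub_right, inner_sub_right] at h
  simp only [Complex.sub_re] at h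
  rw [hdiag i0, hdiag i1, hoff i0 i1 h01, hoff i1 i0 h01.symm] at h
  linarith

/-- **Free-constant criterion in split form**: for `1 ≤ N`, `χ₊ = α + N β ≤ α = D` iff the
exchange part is non-positive, `β ≤ 0`. [folklore] -/
theorem SoloInformed.direct_dominates_iff {α β : ℝ} (hN : 1 ≤ N) :
    α + (N : ℝ) * β ≤ α ↔ β ≤ 0 := by
  have hNpos : (0 : ℝ) < N := by exact_mod_cast hN
  constructor
  · intro h; nlinarith
  · intro h; nlinarith

end Exchange

end Summit.AtomisticToContinuum.BoseEinsteinCondensation.Theorems
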